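import Summits.NavierStokesRegularity.FluidComputer.PalasekTowerTameCarrierAtRun
import Summits.NavierStokesRegularity.FluidComputer.PalasekTowerGermHostIsometry
import Summits.NavierStokesRegularity.FluidComputer.PalasekTowerGermHostSymmetry
import Literature.Analysis.FluidPDE.AxisymmetricEuler

/-! Sketch (cstrat-19179 g3): the FIRST LEMMAS of stubs D2a/D2b of line «doormirror» (v3) — signatures only (planner; not a skeleton,
not registered). D2c = the blob of record is already sterile (warm-up of D2a); D2b-atom = the composite «carrier ⊕ W translated ALONG THE
AXIS» is sterile (the one new lemma of the plumbing stub D2b — the isometry covariance of `accel`/`germForce`/`lineForce` is LANDED: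
ecbridge-3 `PalasekTowerGermHostIsometry`, 2026-08-27); D2a-run = the sterile tame carrier WITH its Kato run under the cap (what D2b extracts
from `SterileSmallCarrierT` by `exists_classical_run_norm_le_two_mul_Icc`, stated here as the shape the superposition door consumes). -/

noncomputable section

namespace Summit.NavierStokesRegularity.NavierStokesRegularity.Cruxes.EpisodeBaseT.DoorMirror.Sketch

open Set MeasureTheory Metric
open scoped ENNReal ContDiff RealInnerProductSpace Laplacian
open Literature.Analysis.FluidPDE
open Summit.NavierStokesRegularity.FluidComputer
open Summit.NavierStokesRegularity.FluidComputer.PalasekTowerClayBridge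
open Summit.NavierStokesRegularity.FluidComputer.PalasekTowerClayBridge.Germ

/-- D2c (warm-up, explicit formula): the blob of record `tinyProfileAt R a = Y₀(R) • B_a`,
`B_a(y) = F(‖y‖²/a²) e₃ − (y₂ G(‖y‖²/a²)/a²) y`, is axisymmetric about the `x 2`-axis and swirl-free. -/
theorem first_lemma_D2c (R : TowerRates) (a : ℝ) :
    IsAxisymmetric (tinyProfileAt R a) ∧ HasNoSwirl (tinyProfileAt R a) := by
  sorry

/-- D2b-atom (the one new lemma of the plumbing): a carrier `U` axisymmetric swirl-free about the `x 2`-axis plus an amplifier `W`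
axisymmetric swirl-free translated ALONG THE AXIS (`c = t • e₃`) is axisymmetric swirl-free (`rotZ θ` is linear and fixes `e₃`;
the swirl is additive). -/
theorem first_lemma_D2b {U W : EuclideanSpace ℝ (Fin 3) → EuclideanSpace ℝ (Fin 3)} (hU : IsAxisymmetric U) (hUs : HasNoSwirl U)
    (hW : IsAxisymmetric W) (hWs : HasNoSwirl W) (t : ℝ) :
    IsAxisymmetric (U + fun x => W (x - t • EuclideanSpace.single 2 (1 : ℝ))) ∧
      HasNoSwirl (U + fun x => W (x - t • EuclideanSpace.single 2 (1 : ℝ))) := by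
  sorry

/-- D2a-run (what the superposition door consumes): a STERILE strict-slot tame carrier at the tuned rates WITH its free run under the
cap — the coaxial twin of `tuned_exists_levelZeroDataAt_tame_freeRun_cap`; from `SterileSmallCarrierT` (blob + coaxial poloidal pusher on
the favourable side; anchor by `anchor_test_iff_fderiv3`, leading term `3(m_⊥ − 2m_z)/(4πh⁴)`) by `exists_classical_run_norm_le_two_mul_Icc`
and `TowerRates.tuned_sep 0`. -/
theorem first_lemma_D2a {η : ℝ} (hη : η ≤ TowerRates.tuned.Y 1 / 3) :
    ∃ U : EuclideanSpace ℝ (Fin 3) → EuclideanSpace ℝ (Fin 3), LevelZeroDataAt TowerRates.tuned U 7 ∧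
      IsAxisymmetric U ∧ HasNoSwirl U ∧
      ∃ (v : ℝ → EuclideanSpace ℝ (Fin 3) → EuclideanSpace ℝ (Fin 3))
        (q : ℝ → EuclideanSpace ℝ (Fin 3) → ℝ),
        IsClassicalNSSolutionOn (Icc 1 (Host.τfirstAt TowerRates.tuned)) 1 0 v q ∧ v 1 = U ∧
        (∃ C : ℝ≥0∞, C < ⊤ ∧ ∀ t ∈ Icc (1 : ℝ) (Host.τfirstAt TowerRates.tuned), ∫⁻ x, ‖v t x‖ₑ ^ 2 ≤ C) ∧
        ∀ t ∈ Icc (1 : ℝ) (Host.τfirstAt TowerRates.tuned), ∀ x, ‖v t x‖ ≤ 5 / 3 * TowerRates.tuned.Y 1 - η := by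
  sorry


/-- **First lemma of D2a's anchor step, PARITY (v4; for fc-prover-2 g11's (F2))** — the far-field pressure work at the blob
centre is COVARIANT under conjugating the far structure by a linear isometry `A` fixing the centre `0`: with
`pot_conj_eq` (GermHostIsometry, unconditional) the pressure of `A ∘ P ∘ A⁻¹` is `π[P] ∘ A⁻¹`, so its gradient at `0` is
`A (∇π[P](0))`. For the REFLECTION `A e₃ = −e₃` through the blob's horizontal plane and `b = Y₀ e₃ = B(0)` this reads
`⟪B 0, ∇π[P̃] 0⟫ = −⟪B 0, ∇π[P] 0⟫`: the strict anchor test of `inner_accel_of_even_add_far` /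
`anchor_test_iff_of_even_add_far` for an even FLAT blob (`⟪B 0, ΔB 0⟫ = 0`) plus a sterile far pusher is EXACTLY ODD in
the side of the placement — (F2) needs `∇π[P](0) ∦ e₃^⊥`, i.e. `⟪e₃, ∇π[P](0)⟫ ≠ 0` for SOME member, plus the choice of side,
not a definite sign at a prescribed side. (Sketch signature; smoothness of `pot` near `0` is GermHost IX.) [folklore] -/
theorem first_lemma_D2a_parity {ν : ℝ} (A : EuclideanSpace ℝ (Fin 3) ≃ₗᵢ[ℝ] EuclideanSpace ℝ (Fin 3))
    {P : EuclideanSpace ℝ (Fin 3) → EuclideanSpace ℝ (Fin 3)} (hP : ContDiff ℝ ∞ P) (hPc : HasCompactSupport P)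
    (h0 : (0 : EuclideanSpace ℝ (Fin 3)) ∉ tsupport P) (b : EuclideanSpace ℝ (Fin 3)) :
    ⟪b, gradient (pot ν (fun y => A (P (A.symm y)))) 0⟫ = ⟪A.symm b, gradient (pot ν P) 0⟫ := by
  sorry

/-- **Corollary (side flip of the composite anchor)**: even flat blob `B` about `0`, sterile pusher `P` off the blob, `A`
a linear isometry with `A (B 0) = − B 0` whose conjugate pusher is also off the blob: the anchor numbers of `B + P` and
`B + A ∘ P ∘ A⁻¹` at `0` are opposite. [folklore] -/
theorem first_lemma_D2a_sideflip {ν : ℝ} (A : EuclideanSpace ℝ (Fin 3) ≃ₗᵢ[ℝ] EuclideanSpace ℝ (Fin 3))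
    {B P : EuclideanSpace ℝ (Fin 3) → EuclideanSpace ℝ (Fin 3)} (hB : ContDiff ℝ ∞ B) (hBc : HasCompactSupport B)
    (hdivB : VectorCalculus.IsDivFree B) (he : IsEvenAbout 0 B) (hflat : ⟪B 0, (Δ B) 0⟫ = 0) (hA : A (B 0) = -B 0)
    (hP : ContDiff ℝ ∞ P) (hPc : HasCompactSupport P) (hd : Disjoint (tsupport B) (tsupport P))
    (hd' : Disjoint (tsupport B) (tsupport fun y => A (P (A.symm y)))) (h0 : (0 : EuclideanSpace ℝ (Fin 3)) ∉ tsupport P)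
    (h0' : (0 : EuclideanSpace ℝ (Fin 3)) ∉ tsupport fun y => A (P (A.symm y))) :
    ⟪(B + fun y => A (P (A.symm y))) 0, accel ν (B + fun y => A (P (A.symm y))) 0⟫ = -⟪(B + P) 0, accel ν (B + P) 0⟫ := by
  sorry

end Summit.NavierStokesRegularity.NavierStokesRegularity.Cruxes.EpisodeBaseT.DoorMirror.Sketch

end
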